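import Literature.Computability.Cryptography.SchemesProofs
import Literature.Computability.Cryptography.PseudorandomFunctions
import Literature.Computability.Complexity.ListBricks
import HarnessLib

/-!
# The memoryless authentication-tree signature scheme (Goldreich 2004, Construction 6.4.16): specification and correctness

Topic `Literature/Computability/Cryptography`. First file of the step "secure ONE-TIME signature schemes
(+ pseudorandom functions) ⇒ secure GENERAL signature schemes" (Goldreich 2004, Thm. 6.4.9 via §6.4.2.2–6.4.2.3:
Merkle's authentication trees, Construction 6.4.14, made memoryless with a pseudorandom function,
Construction 6.4.16; Prop. 6.4.15 / 6.4.17) of Goldreich's proof of Thm. 6.4.1 (= Rompel 1990: one-way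
functions ⇒ EUF-CMA signatures; the tree's named fact `secureSignaturesExist_of_OWFExist`).

We fix the data `P : TreeSig.Spec` — a one-time scheme `S = (G, S, V)`, a function ensemble `F` (key length
`κ`), the coin polynomials `pG` of `G` and `pS` of `S`, a polynomial `CS` bounding the coins the signer of `S`
actually reads at level `n`, and a polynomial `PK` bounding the verification keys of `G(1ⁿ)` — and define the
stateless tree scheme `TreeSig.scheme P` over bit strings:

* node labels are bit strings `L` of length `≤ n` (root `ε`, children `L0`, `L1`, leaves of length `n`), coded
  injectively on `n + 1` bits by `code n L = L 1 0^{n-|L|}`; the BLOCK of a node is `F n k (code n L)`, of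
  which the first `pG(n)` bits are the coins of its one-time key pair `keyOf` and the next `CS(n)` bits, fitted
  to the signer's budget, the coins of the (single) one-time signature produced at that node (`signOf`);
* `G'(1ⁿ; k)`, `k ∈ {0,1}^{κ(n)}` the PRF seed: `sk' = ⟨1ⁿ, k⟩`, `pk' = ⟨1ⁿ, ⟨pk_ε, 0^{2(PK(n)-|pk_ε|)}⟩⟩` (the
  root key, padded so that `|pk'|` depends on `n` only);
* `S'(⟨1ⁿ, k⟩, α; ρ)`: the LEAF `σ = ρ ↾ n` is chosen afresh for every signature (the signer reads exactly `n`
  coins whatever the document); the signature is the coded list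
  `σ, (pk_{σ|ⱼ0}, pk_{σ|ⱼ1}, β_j)_{j<n}, β_n` where `β_j` is the one-time signature, under the key of the node
  `σ|ⱼ`, of the pair code `⟨pk_{σ|ⱼ0}, pk_{σ|ⱼ1}⟩` of its children's keys, and `β_n` the one-time signature of
  `α` under the leaf's key (`chain`, `sigOf`) — Goldreich's Construction 6.4.16 with the document signed at a
  uniformly chosen leaf (the variant of §6.4.2.3 that frees the scheme from the length restriction
  `|α| = n` of Construction 6.4.14; two documents at the same leaf is the birthday event of the security proof);
* `V'` checks `|σ| = n` and walks the authentication path: the root key authenticates `⟨pk₀₀, pk₀₁⟩` via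
  `β₀`, the key `pk_{j,σ_j}` just authenticated authenticates the next pair, and the last one authenticates
  `α` (`checkChain`, exactly the verifier of Construction 6.4.14).

Main results of this file: the structural lemmas (`code_injective`, lengths), and **`TreeSig.isCorrect`**:
under the bookkeeping hypotheses `Spec.WF` (the coin polynomials are those of `S`, blocks have length
`pG(n) + CS(n)`, `S` is correct) the tree scheme is (perfectly) correct. Efficiency (`IsEfficient`) and security
are the subject of the companion files `TreeSigPrograms.lean`, `TreeSig*.lean`.

All statements proved; no named facts.

## References

* O. Goldreich, *Foundations of Cryptography II: Basic Applications*, CUP 2004, §6.4.2.2 (Construction 6.4.14,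
  Prop. 6.4.15), §6.4.2.3 (Construction 6.4.16, Prop. 6.4.17), Thm. 6.4.9.
* R. C. Merkle, *A certified digital signature*, CRYPTO '89, LNCS 435 (1990).
* O. Goldreich, *Two remarks concerning the Goldwasser–Micali–Rivest signature scheme*, CRYPTO '86 (memoryless
  signing via pseudorandom functions).
-/

namespace Literature.Computability.Cryptography

open _root_.Computability Complexity Complexity.Brick Polynomial

namespace TreeSig

/-! ### The data -/

/-- The data of the tree scheme: the one-time scheme `S`, the function ensemble `F` with key length `κ`
(used at level `n` on `n + 1`-bit inputs), the coin polynomials `pG` (of `G`) and `pS` (of the signer), the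
polynomial `CS` of coins read by the signer at level `n`, and the bound `PK` on verification keys.
[Goldreich 2004, Construction 6.4.16] [cite: Goldreich2004, Construction 6.4.16] -/
structure Spec where
  /-- the one-time signature scheme `(G, S, V)` -/
  S : SignatureScheme
  /-- the (pseudorandom) function ensemble -/
  F : FunctionEnsemble
  /-- key length of `F` -/
  κ : ℕ → ℕ
  /-- coin polynomial of `G`: `G.coinLen n = pG(n)` -/
  pG : Polynomial ℕ
  /-- coin polynomial of the signer: `S.coinLen ℓ = pS(ℓ)` -/
  pS : Polynomial ℕ
  /-- coins read by the signer under keys of `G(1ⁿ)` -/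
  CS : Polynomial ℕ
  /-- bound on the verification keys of `G(1ⁿ)` -/
  PK : Polynomial ℕ

namespace Spec

variable (P : Spec)

/-- The block length `R(n) = pG(n) + CS(n)` (output length of `F` at level `n`). [folklore] -/
noncomputable def R : Polynomial ℕ := P.pG + P.CS

/-- The bookkeeping hypotheses: `pG`, `pS` ARE the coin budgets of `G` and of the signer, verification keys of
`G(1ⁿ)` have length `≤ PK(n)`, `F n` maps well-formed `(k, x)` to blocks of length `R(n)`, and `S` is correct.
[Goldreich 2004, Def. 6.1.1, Construction 6.4.16] [cite: Goldreich2004, Construction 6.4.16] -/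
structure WF : Prop where
  /-- `G.coinLen = pG` -/
  hcG : ∀ n, P.S.keyGen.coinLen n = P.pG.eval n
  /-- `S.coinLen = pS` -/
  hcS : ∀ ℓ, P.S.sign.coinLen ℓ = P.pS.eval ℓ
  /-- verification keys are short -/
  hPK : ∀ (n : ℕ) (c : List Bool), c.length = P.pG.eval n → (P.S.keyGen.run n c).1.length ≤ P.PK.eval n
  /-- blocks have length `R(n)` -/
  hF : ∀ (n : ℕ) (k x : List Bool), k.length = P.κ n → x.length = n + 1 → (P.F n k x).length = P.R.eval n
  /-- `S` is correct -/
  hcorr : P.S.IsCorrect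

end Spec

/-! ### Labels, codes, blocks -/

/-- The code of a node label `L` (`|L| ≤ n`) on `n + 1` bits: `L 1 0^{n - |L|}`. [Goldreich 2004, §6.4.2.2
(nodes labelled by strings of length `≤ n`)] [cite: Goldreich2004, Construction 6.4.14] -/
def code (n : ℕ) (L : List Bool) : List Bool := L ++ true :: List.replicate (n - L.length) false

/-- `|code n L| = n + 1` for `|L| ≤ n`. [folklore] -/
theorem length_code {n : ℕ} {L : List Bool} (h : L.length ≤ n) : (code n L).length = n + 1 := by
  simp only [code, List.length_append, List.length_cons, List.length_replicate]; omega

/-- Stripping the padding: `(0ᵃ 1 l).dropWhile (· = 0) = 1 l`. [folklore] -/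
theorem dropWhile_replicate_false_append (a : ℕ) (l : List Bool) :
    (List.replicate a false ++ true :: l).dropWhile (fun b => b == false) = true :: l := by
  induction a with
  | zero => simp
  | succ a _ => simp [List.replicate_succ]

/-- The reversed code: `0^{n-|L|} 1 L⁻¹`. [folklore] -/
theorem reverse_code (n : ℕ) (L : List Bool) : (code n L).reverse = List.replicate (n - L.length) false ++ true :: L.reverse := by
  simp [code]

/-- `code n` is injective. [folklore] -/
theorem code_injective (n : ℕ) : Function.Injective (code n) := fun L L' h => by
  have h1 := congrArg (fun w : List Bool => (w.reverse.dropWhile fun b => b == false)) h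
  simp only [reverse_code, dropWhile_replicate_false_append, List.cons.injEq, true_and] at h1
  exact List.reverse_injective h1

/-- The children labels met along the leaf `σ` below the prefix `pre`: `pre σ₁⋯σⱼ 0`, `pre σ₁⋯σⱼ 1` for
`j = 0, 1, …`. [Goldreich 2004, Construction 6.4.14 (signing, step 2)] [cite: Goldreich2004, Construction 6.4.14] -/
def pathLabelsFrom : List Bool → List Bool → List (List Bool)
  | _, [] => []
  | pre, b :: σ => (pre ++ [false]) :: (pre ++ [true]) :: pathLabelsFrom (pre ++ [b]) σ

/-- The `2|σ|` children labels along the leaf `σ`: `σ|ⱼ0, σ|ⱼ1` for `j < |σ|`. [Goldreich 2004,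
Construction 6.4.14] [cite: Goldreich2004, Construction 6.4.14] -/
def pathLabels (σ : List Bool) : List (List Bool) := pathLabelsFrom [] σ

/-- `pathLabelsFrom pre σ` has `2|σ|` entries. [folklore] -/
theorem length_pathLabelsFrom : ∀ (pre σ : List Bool), (pathLabelsFrom pre σ).length = 2 * σ.length
  | _, [] => rfl
  | pre, b :: σ => by
    simp only [pathLabelsFrom, List.length_cons, length_pathLabelsFrom (pre ++ [b]) σ]; omega

/-- `pathLabels σ` has `2|σ|` entries. [folklore] -/
theorem length_pathLabels (σ : List Bool) : (pathLabels σ).length = 2 * σ.length := length_pathLabelsFrom [] σ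

/-- Labels along a path have length `≤ |pre| + |σ|`. [folklore] -/
theorem length_le_of_mem_pathLabelsFrom : ∀ (pre σ : List Bool) {L : List Bool},
    L ∈ pathLabelsFrom pre σ → L.length ≤ pre.length + σ.length
  | _, [], L, h => by simp [pathLabelsFrom] at h
  | pre, b :: σ, L, h => by
    simp only [pathLabelsFrom, List.mem_cons] at h
    rcases h with rfl | rfl | h
    · simp
    · simp
    · have := length_le_of_mem_pathLabelsFrom (pre ++ [b]) σ h
      simp only [List.length_append, List.length_cons, List.length_nil] at this ⊢; omega

/-- Labels along the leaf `σ` have length `≤ |σ|`. [folklore] -/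
theorem length_le_of_mem_pathLabels {σ L : List Bool} (h : L ∈ pathLabels σ) : L.length ≤ σ.length := by
  simpa using length_le_of_mem_pathLabelsFrom [] σ h

variable (P : Spec)

/-- The block of the node `L` at level `n` under the seed `k`: `F n k (code n L)`. [Goldreich 2004,
Construction 6.4.16 ("`r_x = f_r(x)`")] [cite: Goldreich2004, Construction 6.4.16] -/
def blk (n : ℕ) (k L : List Bool) : List Bool := P.F n k (code n L)

/-- The one-time key pair of a node, generated from the first `pG(n)` bits of its block.
[Goldreich 2004, Construction 6.4.16 (step 2: "`(s_x, v_x) ← G(1ⁿ, f_r(key, x))`")] [cite: Goldreich2004, Construction 6.4.16] -/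
def keyOf (n : ℕ) (b : List Bool) : List Bool × List Bool := P.S.keyGen.run n (b.take (P.pG.eval n))

/-- The verification key of a node. [Goldreich 2004, Construction 6.4.16] [cite: Goldreich2004, Construction 6.4.16] -/
def pkOf (n : ℕ) (b : List Bool) : List Bool := (keyOf P n b).1

/-- The signing key of a node. [Goldreich 2004, Construction 6.4.16] [cite: Goldreich2004, Construction 6.4.16] -/
def skOf (n : ℕ) (b : List Bool) : List Bool := (keyOf P n b).2

/-- Cut or pad (with `0`s) a string to length exactly `m`. [folklore] -/
def fitLen (w : List Bool) (m : ℕ) : List Bool := w.take m ++ List.replicate (m - w.length) false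

/-- `|fitLen w m| = m`. [folklore] -/
@[simp] theorem length_fitLen (w : List Bool) (m : ℕ) : (fitLen w m).length = m := by
  simp only [fitLen, List.length_append, List.length_take, List.length_replicate]; omega

/-- The signing coins of a node for the message `m`: bits `pG(n) … pG(n) + CS(n) - 1` of its block, fitted to
the signer's budget `pS(|⟨sk, m⟩|)`. [Goldreich 2004, Construction 6.4.16 (step 3: "`S_{s_x}(…, f_r(sign, x))`")]
[cite: Goldreich2004, Construction 6.4.16] -/
def coinsOf (n : ℕ) (b m : List Bool) : List Bool :=
  fitLen ((b.drop (P.pG.eval n)).take (P.CS.eval n)) (P.pS.eval (pairCode (skOf P n b, m)).length)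

/-- The one-time signature produced at a node (block `b`) on the message `m`. [Goldreich 2004,
Construction 6.4.16 (step 3)] [cite: Goldreich2004, Construction 6.4.16] -/
def signOf (n : ℕ) (b m : List Bool) : List Bool := P.S.sign.run (skOf P n b, m) (coinsOf P n b m)

/-! ### The signature: the authentication path and the leaf signature -/

/-- The items of a signature below a node of block `par` along the remaining leaf bits, the children blocks
being supplied in path order: per level the two children keys and the one-time signature of their pair code
under the parent's key, then the one-time signature of the document under the last (leaf) key.
[Goldreich 2004, Construction 6.4.14 (signing, steps 2–4) / 6.4.16] [cite: Goldreich2004, Construction 6.4.14] -/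
def chain (n : ℕ) (α : List Bool) : List Bool → List Bool → List (List Bool) → List (List Bool)
  | par, [], _ => [signOf P n par α]
  | par, b :: σ, blks =>
    pkOf P n (blks.getD 0 []) :: pkOf P n (blks.getD 1 []) ::
      signOf P n par (boolPair (pkOf P n (blks.getD 0 [])) (pkOf P n (blks.getD 1 []))) ::
        chain n α (if b then blks.getD 1 [] else blks.getD 0 []) σ (blks.drop 2)

/-- The signature of `α` at the leaf `σ` under the seed `k` (level `n`): the coded list
`σ, pk₀₀, pk₀₁, β₀, …, β_n`. [Goldreich 2004, Construction 6.4.16] [cite: Goldreich2004, Construction 6.4.16] -/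
def sigOf (n : ℕ) (k α σ : List Bool) : List Bool :=
  encList (σ :: chain P n α (blk P n k []) σ ((pathLabels σ).map (blk P n k)))

/-- The signing algorithm `S'(⟨1ⁿ, k⟩, α; ρ)`: sign at the leaf `σ = ρ ↾ n` (coin budget: the input length,
of which only the first `n` coins are read). [Goldreich 2004, Construction 6.4.16] [cite: Goldreich2004, Construction 6.4.16] -/
def signT : RandAlg (List Bool × List Bool) (List Bool) where
  run p ρ := sigOf P (fstF p.1).length (sndF p.1) p.2 (ρ.take (fstF p.1).length)
  coinLen ℓ := ℓ

/-- The padded root key `⟨pk_ε, 0^{2(PK(n) - |pk_ε|)}⟩` (of length `2 PK(n) + 2` whenever `|pk_ε| ≤ PK(n)`).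
[folklore] -/
def padPk (n : ℕ) (pk : List Bool) : List Bool := boolPair pk (List.replicate (2 * (P.PK.eval n - pk.length)) false)

/-- Key generation `G'(1ⁿ; k) = (⟨1ⁿ, padded pk_ε⟩, ⟨1ⁿ, k⟩)`, the seed `k ∈ {0,1}^{κ(n)}` being the coins.
[Goldreich 2004, Construction 6.4.16 (key generation)] [cite: Goldreich2004, Construction 6.4.16] -/
def keyGenT : RandAlg ℕ (List Bool × List Bool) where
  run n k := (boolPair (ones n) (padPk P n (pkOf P n (blk P n k []))), boolPair (ones n) k)
  coinLen := P.κ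

/-- The verifier's walk down the authentication path: with the key `key` held authentic and remaining leaf
bits `σ`, check the one-time signature of the claimed pair of children keys, continue with the claimed key of
the child on the path; at the leaf check the one-time signature of the document. [Goldreich 2004,
Construction 6.4.14 (verification `V'`)] [cite: Goldreich2004, Construction 6.4.14] -/
def checkChain (α : List Bool) : List Bool → List Bool → List Bool → Bool
  | key, [], rest => P.S.verify key α (nthF 0 rest)
  | key, b :: σ, rest =>
    P.S.verify key (boolPair (nthF 0 rest) (nthF 1 rest)) (nthF 2 rest) &&
      checkChain α (if b then nthF 1 rest else nthF 0 rest) σ (sndPow 2 rest)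

/-- Verification `V'(⟨1ⁿ, pk⟩, α, sig)`: the leaf has length `n` and the path authenticates.
[Goldreich 2004, Construction 6.4.14 / 6.4.16 (verification)] [cite: Goldreich2004, Construction 6.4.14] -/
def verifyT (pkT α sig : List Bool) : Bool :=
  decide ((fstF sig).length = (fstF pkT).length) && checkChain P α (fstF (sndF pkT)) (fstF sig) (sndF sig)

/-- **Construction 6.4.16** (memoryless authentication-tree signatures, document signed at a random leaf) as a
`SignatureScheme`. [Goldreich 2004, Construction 6.4.16] [cite: Goldreich2004, Construction 6.4.16] -/
def scheme : SignatureScheme where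
  keyGen := keyGenT P
  sign := signT P
  verify := verifyT P

/-! ### Structural lemmas -/

/-- Field `0` of a coded list. [folklore] -/
@[simp] theorem nthF_zero_encList_cons (a : List Bool) (l : List (List Bool)) : nthF 0 (encList (a :: l)) = a := by
  rw [nthF_zero, encList_cons, fstF_boolPair]

/-- Field `i + 1` of a coded list. [folklore] -/
@[simp] theorem nthF_succ_encList_cons (i : ℕ) (a : List Bool) (l : List (List Bool)) :
    nthF (i + 1) (encList (a :: l)) = nthF i (encList l) := by
  rw [encList_cons, nthF_succ_boolPair]

/-- The coded list after its first field. [folklore] -/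
@[simp] theorem sndPow_zero_encList_cons (a : List Bool) (l : List (List Bool)) : sndPow 0 (encList (a :: l)) = encList l := by
  rw [encList_cons, sndPow_zero_boolPair]

/-- The coded list after its first `i + 2` fields. [folklore] -/
@[simp] theorem sndPow_succ_encList_cons (i : ℕ) (a : List Bool) (l : List (List Bool)) :
    sndPow (i + 1) (encList (a :: l)) = sndPow i (encList l) := by
  rw [encList_cons, sndPow_succ_boolPair]

/-- The chain has `3|σ| + 1` items. [folklore] -/
theorem length_chain (n : ℕ) (α : List Bool) : ∀ (par σ : List Bool) (blks : List (List Bool)),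
    (chain P n α par σ blks).length = 3 * σ.length + 1
  | _, [], _ => rfl
  | par, b :: σ, blks => by simp only [chain, List.length_cons, length_chain n α _ σ]; omega

/-- The leaf of a signature. [folklore] -/
@[simp] theorem fstF_sigOf (n : ℕ) (k α σ : List Bool) : fstF (sigOf P n k α σ) = σ := by
  rw [sigOf, encList_cons, fstF_boolPair]

/-- The items of a signature. [folklore] -/
@[simp] theorem sndF_sigOf (n : ℕ) (k α σ : List Bool) :
    sndF (sigOf P n k α σ) = encList (chain P n α (blk P n k []) σ ((pathLabels σ).map (blk P n k))) := by
  rw [sigOf, encList_cons, sndF_boolPair]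

/-- The root key read off the padded verification key. [folklore] -/
@[simp] theorem fstF_padPk (n : ℕ) (pk : List Bool) : fstF (padPk P n pk) = pk := fstF_boolPair _ _

/-- `|padPk n pk| = 2 PK(n) + 2` for `|pk| ≤ PK(n)`. [folklore] -/
theorem length_padPk {n : ℕ} {pk : List Bool} (h : pk.length ≤ P.PK.eval n) : (padPk P n pk).length = 2 * P.PK.eval n + 2 := by
  simp only [padPk, length_boolPair, List.length_replicate]; omega

/-- The verification key of `G'(1ⁿ; k)`. [folklore] -/
theorem keyGenT_run_fst (n : ℕ) (k : List Bool) :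
    ((keyGenT P).run n k).1 = boolPair (ones n) (padPk P n (pkOf P n (blk P n k []))) := rfl

/-- The signing key of `G'(1ⁿ; k)` is `⟨1ⁿ, k⟩`. [folklore] -/
theorem keyGenT_run_snd (n : ℕ) (k : List Bool) : ((keyGenT P).run n k).2 = boolPair (ones n) k := rfl

/-- `|pk'| = 2n + 2 PK(n) + 4` — the verification key has a length depending on `n` only (for `|pk_ε| ≤ PK(n)`).
[folklore] -/
theorem length_keyGenT_run_fst {n : ℕ} {k : List Bool} (h : (pkOf P n (blk P n k [])).length ≤ P.PK.eval n) :
    ((keyGenT P).run n k).1.length = 2 * n + 2 * P.PK.eval n + 4 := by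
  rw [keyGenT_run_fst, length_boolPair, length_padPk P h, List.length_replicate]; ring

/-- The signature of `⟨1ⁿ, k⟩` on `α` with coins `ρ`. [folklore] -/
theorem signT_run (n : ℕ) (k α ρ : List Bool) :
    (signT P).run (boolPair (ones n) k, α) ρ = sigOf P n k α (ρ.take n) := by
  simp [signT]

/-- **The tree signer reads exactly `n` of its coins** (hypothesis `hread` of `SignaturesManyAnswers.lean`, with
`C = n`, for keys of `G'(1ⁿ)`). [Goldreich 2004, Construction 6.4.16] [folklore] -/
theorem signT_run_take (n : ℕ) (k α ρ : List Bool) :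
    (signT P).run (boolPair (ones n) k, α) ρ = (signT P).run (boolPair (ones n) k, α) (ρ.take n) := by
  rw [signT_run, signT_run, List.take_take, min_self]

/-! ### Correctness -/

section Correctness

variable {P}

/-- A well-formed block: one of length `R(n)`. [folklore] -/
def WFBlock (n : ℕ) (b : List Bool) : Prop := b.length = P.R.eval n

/-- `pG(n) ≤ R(n)`. [folklore] -/
theorem pG_le_R (n : ℕ) : P.pG.eval n ≤ P.R.eval n := by
  rw [Spec.R, eval_add]; exact Nat.le_add_right _ _

/-- The key pair of a well-formed block is in the range of `G(1ⁿ)`. [Goldreich 2004, Def. 6.1.1] [folklore] -/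
theorem keyOf_mem_support (hW : P.WF) {n : ℕ} {b : List Bool} (hb : WFBlock (P := P) n b) :
    keyOf P n b ∈ (P.S.keyPMF n).support := by
  refine SigOWF.FParams.mem_support_keyPMF P.S n _ ?_
  rw [List.length_take, hW.hcG, hb]
  exact min_eq_left (pG_le_R n)

/-- The one-time signature produced at a well-formed node is in the range of the signer. [Goldreich 2004,
Def. 6.1.1] [folklore] -/
theorem signOf_mem_support (hW : P.WF) (n : ℕ) (b m : List Bool) :
    signOf P n b m ∈ (P.S.sigPMF (skOf P n b) m).support := by
  refine SigOWF.FParams.mem_support_sigPMF P.S _ m _ ?_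
  rw [coinsOf, length_fitLen, hW.hcS]

/-- **One-time signatures at well-formed nodes verify.** [Goldreich 2004, Def. 6.1.1 (correctness of `S`)] [folklore] -/
theorem verify_signOf (hW : P.WF) {n : ℕ} {b : List Bool} (hb : WFBlock (P := P) n b) (m : List Bool) :
    P.S.verify (pkOf P n b) m (signOf P n b m) = true :=
  hW.hcorr n _ (keyOf_mem_support hW hb) m _ (signOf_mem_support hW n b m)

/-- **The honest path authenticates**: the verifier's walk accepts the chain produced by the signer, from any
well-formed node with well-formed children blocks. [Goldreich 2004, Construction 6.4.14 (correctness: "the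
reader may verify that `V'` accepts every valid signature")] [cite: Goldreich2004, Construction 6.4.14] -/
theorem checkChain_chain (hW : P.WF) {n : ℕ} (α : List Bool) : ∀ (par σ : List Bool) (blks : List (List Bool)),
    WFBlock (P := P) n par → (∀ b ∈ blks, WFBlock (P := P) n b) → blks.length = 2 * σ.length →
      checkChain P α (pkOf P n par) σ (encList (chain P n α par σ blks)) = true
  | par, [], blks, hpar, _, _ => by
    rw [chain, checkChain, nthF_zero_encList_cons]
    exact verify_signOf hW hpar α
  | par, b :: σ, blks, hpar, hblks, hlen => by
    obtain ⟨c0, c1, rest, rfl⟩ : ∃ c0 c1 rest, blks = c0 :: c1 :: rest := by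
      match blks, hlen with
      | c0 :: c1 :: rest, _ => exact ⟨c0, c1, rest, rfl⟩
    have h0 : WFBlock (P := P) n c0 := hblks c0 (by simp)
    have h1 : WFBlock (P := P) n c1 := hblks c1 (by simp)
    have hrest : ∀ b ∈ rest, WFBlock (P := P) n b := fun b hb => hblks b (by simp [hb])
    have hlen' : rest.length = 2 * σ.length := by simp only [List.length_cons] at hlen; omega
    simp only [chain, List.getD_cons_zero, List.getD_cons_succ, List.drop_succ_cons, List.drop_zero]
    rw [checkChain]
    simp only [nthF_zero_encList_cons, nthF_succ_encList_cons, sndPow_succ_encList_cons, sndPow_zero_encList_cons,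
      Bool.and_eq_true]
    refine ⟨verify_signOf hW hpar _, ?_⟩
    cases b
    · exact checkChain_chain hW α c0 σ rest h0 hrest hlen'
    · exact checkChain_chain hW α c1 σ rest h1 hrest hlen'

/-- Blocks of labels of length `≤ n` under a seed of length `κ(n)` are well formed. [folklore] -/
theorem wfBlock_blk (hW : P.WF) {n : ℕ} {k : List Bool} (hk : k.length = P.κ n) {L : List Bool} (hL : L.length ≤ n) :
    WFBlock (P := P) n (blk P n k L) :=
  hW.hF n k _ hk (length_code hL)

/-- **The verifier accepts honest signatures** (seed of length `κ(n)`, leaf of length `n`). [Goldreich 2004,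
Construction 6.4.16] [cite: Goldreich2004, Construction 6.4.16] -/
theorem verifyT_sigOf (hW : P.WF) {n : ℕ} {k : List Bool} (hk : k.length = P.κ n) (α : List Bool) {σ : List Bool}
    (hσ : σ.length = n) :
    verifyT P ((keyGenT P).run n k).1 α (sigOf P n k α σ) = true := by
  rw [keyGenT_run_fst, verifyT, fstF_sigOf, fstF_boolPair, sndF_boolPair, fstF_padPk, sndF_sigOf, List.length_replicate, hσ]
  simp only [decide_true, Bool.true_and]
  refine checkChain_chain hW α _ σ _ (wfBlock_blk hW hk (by simp)) (fun b hb => ?_) (by rw [List.length_map, length_pathLabels])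
  obtain ⟨L, hL, rfl⟩ := List.mem_map.1 hb
  exact wfBlock_blk hW hk ((length_le_of_mem_pathLabels hL).trans hσ.le)

/-- The keys in the range of `G'(1ⁿ)`. [folklore] -/
theorem exists_of_mem_support_keyPMF {n : ℕ} {ks : List Bool × List Bool} (h : ks ∈ ((scheme P).keyPMF n).support) :
    ∃ k : List Bool, k.length = P.κ n ∧ ks = (keyGenT P).run n k := by
  rw [SignatureScheme.keyPMF, RandAlg.outputPMF, PMF.support_map] at h
  obtain ⟨v, -, rfl⟩ := h
  refine ⟨v.toList, ?_, rfl⟩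
  rw [v.toList_length]
  show (keyGenT P).coinLen (unaryEncodeNat n).length = P.κ n
  rw [Complexity.unaryEncodeNat_eq_replicate, List.length_replicate]; rfl

/-- The signatures in the range of `S'(⟨1ⁿ, k⟩, α)`: honest signatures at leaves of length `n`. [folklore] -/
theorem exists_of_mem_support_sigPMF {n : ℕ} {k α s : List Bool} (h : s ∈ ((scheme P).sigPMF (boolPair (ones n) k) α).support) :
    ∃ σ : List Bool, σ.length = n ∧ s = sigOf P n k α σ := by
  rw [SignatureScheme.sigPMF, RandAlg.outputPMF, PMF.support_map] at h
  obtain ⟨v, -, rfl⟩ := h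
  refine ⟨v.toList.take n, ?_, ?_⟩
  · rw [List.length_take, v.toList_length]
    refine min_eq_left ?_
    show n ≤ (signT P).coinLen (pairCode (boolPair (ones n) k, α)).length
    simp only [signT, pairCode, Function.uncurry, length_boolPair, List.length_replicate]; omega
  · exact signT_run P n k α v.toList

/-- **Correctness of Construction 6.4.16.** [Goldreich 2004, Construction 6.4.16 with Def. 6.1.1]
[cite: Goldreich2004, Construction 6.4.16] -/
theorem isCorrect (hW : P.WF) : (scheme P).IsCorrect := by
  intro n ks hks α s hs
  obtain ⟨k, hk, rfl⟩ := exists_of_mem_support_keyPMF hks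
  rw [keyGenT_run_snd] at hs
  obtain ⟨σ, hσ, rfl⟩ := exists_of_mem_support_sigPMF hs
  exact verifyT_sigOf hW hk α hσ

end Correctness

end TreeSig

end Literature.Computability.Cryptography
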